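import Literature.NumberTheory.EllipticCurves.HeegnerPointsKolyvaginPrimaryOrderTelescopeProofs
import HarnessLib

/-!
# Kolyvagin's bound on the order of `Ш(E/K)[p^∞]`, REFINED by global divisibility: the Cassels–Tate
# telescope with a divisible top class (McCallum 1991 Cor. 5.6 read as `∑ Nᵢ ≤ M₀ − m`; Jetchev 2008 (1))

Sibling proof file of `HeegnerPointsKolyvaginPrimaryOrderTelescopeProofs` (the abstract descent data
`KolyvaginDescent.HypothesesM` on `V = H¹(K, E_{p^M})`, McCallum 1991 §§2–5 modulo `p^M`), theorems
only: **no definition and no named fact is introduced** (D-0026). Written by the cell `bsd-stepL`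
(seat `bsd-stepL-tam3-p1` g9, crux item stmt-BirchSwinnertonDyer-19109 `EulerHalvesAtThree`), whose
Kolyvagin-side input is the named fact
`McCallum1991_padicValNat_card_sha_primary_add_le_of_globalDivisibility`
(`KolyvaginShaStructureDivisibility.lean`): *`ord_p #Ш(E/K)[p^∞] + 2t ≤ 2M₀` when every derived
Heegner point `P_n` is `p^t`-divisible* — McCallum's Cor. 5.6 *"`ord_p|Ш(E/K)| = 2(M_0 − m)`,
`m = min Mᵢ`"* read as the upper bound together with `m ≥ t`, the half that Jetchev, Compos. Math.
144 (2008) p. 812 (1) and Cor. 1.5 consume. This file proves the ABSTRACT CORE of that refinement.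

## What is proved

`KolyvaginDescent.HypothesesM.sum_expo_add_le_M₀_of_casselsTate_of_pow_smul_c_eq_zero`: under
EXACTLY the hypotheses of the sibling's `sum_expo_le_M₀_of_casselsTate` (eigen-lifts `s₁, …, s_K ∈ Sel`
of a maximal isotropic `⊕ Dᵢ` of `Ш(E/K)_{p^∞}`, independent together with `x`, pairwise isotropic for
the pulled-back Cassels–Tate pairing `P`, with room `ord sᵢ · p^{M₀} ∣ p^M`; McCallum's Prop. 4.7 /
Lemma 5.3 / Prop. 4.4 in order language `hCTV`; Prop. 3.1 in kernel form `hCeb`) PLUS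
* `hdiv` — **global divisibility to depth `t` at the top of the chain**: every Kolyvagin class `c_M(n)`
  of a square-free product `n` of `K` Kolyvagin primes is killed by `p^{M−t}` (for the Heegner-point
  datum: `P_n ∈ p^t E(K_n)`, since `res ∘ c_M(n) = δ'(P_n)` with `res` injective, McCallum (5)–(6) and
  Cor. 4.5; this is Jetchev's `m(c) ≥ t`, i.e. McCallum's `M_K ≥ t`),
and `t ≤ M`, `M₀ ≤ M`: **`∑ᵢ ord_p(ord sᵢ) + t ≤ M₀`**, i.e. `∑ Nᵢ ≤ M₀ − t`, whence
`#Ш(E/K)_{p^∞} = (#D)² ≤ p^{2(M₀ − t)}` by the sibling files' symplectic count.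

## The proof

The sibling's chain `n_K = ℓ₁ ⋯ ℓ_K` with its invariant **(I)**
*`p^i c(n_k) ∈ ⟨s_j : j > k⟩ ⟹ (M − M₀) + N₁ + ⋯ + N_k ≤ i`* (`exists_chain_of_casselsTate`) is used
VERBATIM; only the terminal step changes: instead of `p^M c(n_K) = 0 ∈ ⟨∅⟩` (everything is
`p^M`-torsion), the divisibility gives `p^{M−t} c(n_K) = 0 ∈ ⟨∅⟩`, so (I) at `i = M − t` reads
`(M − M₀) + ∑ Nᵢ ≤ M − t`. No optimality of the chain, no Prop. 5.2, no lower bound is used — exactly as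
in the sibling; the refinement costs nothing beyond the divisibility of the TOP class of the chain.

## References

* W. G. McCallum, *Kolyvagin's work on Shafarevich–Tate groups*, in *`L`-functions and arithmetic
  (Durham, 1989)*, LMS Lecture Note Ser. 153, CUP (1991), 295–316: §4 (5), (6), Cor. 4.5, Lemma 4.6;
  §5 Lemma 5.1, Thm. 5.4 (proof, (16)–(23)), Cor. 5.5, Cor. 5.6 (held `book:editornd-l-functions-arithmetic`,
  PDF pp. 281–290). [McCallumLMS1991]
* D. Jetchev, *Global divisibility of Heegner points and Tamagawa numbers*, Compos. Math. 144 (2008)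
  811–826: p. 812 (1) `#Ш(E/K)[p^∞] = p^{2(m₀ − m_∞)}` and Cor. 1.5 (held `paper:arxiv-math_0703431`).
  [Jetchev2008]
* V. A. Kolyvagin, *On the structure of Shafarevich–Tate groups*, Algebraic geometry (Chicago 1989),
  LNM 1479 (1991), 94–121 (cite only).
-/

open scoped Classical

namespace Literature.NumberTheory.EllipticCurves

namespace KolyvaginDescent

namespace HypothesesM

variable {V : Type*} [AddCommGroup V] {Pl : Type*} (S : HypothesesM V Pl)

/-- **Kolyvagin's bound on the order of `Ш(E/K)_{p^∞}` REFINED by global divisibility — telescope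
form (McCallum 1991 Cor. 5.6 *"`ord_p|Ш(E/K)| = 2(M_0 − m)`"* as the inequality `∑ Nᵢ ≤ M₀ − t` for
`t ≤ m`; Jetchev 2008 (1)).** Under the hypotheses of `sum_expo_le_M₀_of_casselsTate` (module
docstring), if moreover every Kolyvagin class `c_M(n)` of a square-free product `n` of `K` Kolyvagin
primes is killed by `p^{M−t}` (`hdiv`: the derived point `P_n` is `p^t`-divisible in `E(K_n)`), with
`t ≤ M` and `M₀ ≤ M`, then **`∑ᵢ ord_p(ord sᵢ) + t ≤ M₀`**. Proof: the sibling's chain with invariant (I)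
(`exists_chain_of_casselsTate`), terminal step at `i = M − t`.
[cite: McCallumLMS1991, §5 Thm. 5.4 (proof), Cor. 5.6 (p. 310); §4 Cor. 4.5]
[cite: Jetchev2008, p. 812 (1) and Cor. 1.5] -/
theorem sum_expo_add_le_M₀_of_casselsTate_of_pow_smul_c_eq_zero {R : Type*} [AddCommGroup R]
    (P : S.Sel →+ S.Sel →+ R)
    (hCTV : ∀ ℓ m : ℕ, S.Kol ℓ → KolSupp S.Kol (ℓ * m) → ¬ ℓ ∣ m →
      ∀ (j N a b : ℕ) (t : V) (ht : t ∈ S.Sel) (hz : ((S.p : ℤ) ^ j) • S.c (ℓ * m) ∈ S.Sel),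
      ((S.p : ℤ) ^ N) • t = 0 → S.τ t = (S.ε * (-1) ^ (ℓ * m).primeFactors.card) • t →
      (∀ q ∈ m.primeFactors, t ∈ S.A q) → S.M - S.M₀ ≤ j → N + S.M₀ ≤ S.M → N ≤ j → a + b + 1 = N →
      ((S.p : ℤ) ^ (a + (j - N))) • S.c m ∉ S.A ℓ → ((S.p : ℤ) ^ b) • t ∉ S.A ℓ →
      P ⟨_, hz⟩ ⟨t, ht⟩ ≠ 0)
    (hCeb : ∀ (T : Finset V) (g₁ g₂ : V) (ν : ℤ), (ν = 1 ∨ ν = -1) → S.τ g₁ = ν • g₁ →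
      S.τ g₂ = (-ν) • g₂ → (∀ t ∈ T, ∃ e : ℤ, (e = 1 ∨ e = -1) ∧ S.τ t = e • t) → ∀ b : ℕ,
      ∃ ℓ, b < ℓ ∧ S.Kol ℓ ∧ ∀ g ∈ AddSubgroup.closure (insert g₁ (insert g₂ (T : Set V))),
        g ∈ S.A ℓ ↔ g ∈ AddSubgroup.closure (T : Set V))
    (K : ℕ) (s : ℕ → V) (hsel : ∀ i, s i ∈ S.Sel)
    (hτs : ∀ i ∈ Finset.Ioc 0 K, S.τ (s i) = (S.ε * (-1) ^ i) • s i)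
    (hiso : ∀ i ∈ Finset.Ioc 0 K, ∀ i' ∈ Finset.Ioc 0 K, P ⟨s i, hsel i⟩ ⟨s i', hsel i'⟩ = 0)
    (hind : ∀ (b : ℤ) (a : ℕ → ℤ), b • S.x + ∑ i ∈ Finset.Ioc 0 K, a i • s i = 0 →
      b • S.x = 0 ∧ ∀ i ∈ Finset.Ioc 0 K, a i • s i = 0)
    (hroom : ∀ i ∈ Finset.Ioc 0 K, S.expo (s i) + S.M₀ ≤ S.M)
    (t : ℕ) (htM : t ≤ S.M) (hM₀ : S.M₀ ≤ S.M)
    (hdiv : ∀ n : ℕ, KolSupp S.Kol n → n.primeFactors.card = K →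
      ((S.p : ℤ) ^ (S.M - t)) • S.c n = 0) :
    ∑ i ∈ Finset.Ioc 0 K, S.expo (s i) + t ≤ S.M₀ := by
  obtain ⟨n, hn, hcard, -, hI⟩ :=
    S.exists_chain_of_casselsTate P hCTV hCeb K s hsel hτs hiso hind hroom K le_rfl
  have := hI (S.M - t) (by rw [hdiv n hn hcard]; exact zero_mem _)
  omega

/-- The same in the sibling's shape, for drop-in use downstream: **`∑ᵢ ord_p(ord sᵢ) ≤ M₀ − t`**.
[cite: McCallumLMS1991, §5 Cor. 5.6 (p. 310)] [cite: Jetchev2008, p. 812 (1) and Cor. 1.5] -/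
theorem sum_expo_le_M₀_sub_of_casselsTate_of_pow_smul_c_eq_zero {R : Type*} [AddCommGroup R]
    (P : S.Sel →+ S.Sel →+ R)
    (hCTV : ∀ ℓ m : ℕ, S.Kol ℓ → KolSupp S.Kol (ℓ * m) → ¬ ℓ ∣ m →
      ∀ (j N a b : ℕ) (t : V) (ht : t ∈ S.Sel) (hz : ((S.p : ℤ) ^ j) • S.c (ℓ * m) ∈ S.Sel),
      ((S.p : ℤ) ^ N) • t = 0 → S.τ t = (S.ε * (-1) ^ (ℓ * m).primeFactors.card) • t →
      (∀ q ∈ m.primeFactors, t ∈ S.A q) → S.M - S.M₀ ≤ j → N + S.M₀ ≤ S.M → N ≤ j → a + b + 1 = N →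
      ((S.p : ℤ) ^ (a + (j - N))) • S.c m ∉ S.A ℓ → ((S.p : ℤ) ^ b) • t ∉ S.A ℓ →
      P ⟨_, hz⟩ ⟨t, ht⟩ ≠ 0)
    (hCeb : ∀ (T : Finset V) (g₁ g₂ : V) (ν : ℤ), (ν = 1 ∨ ν = -1) → S.τ g₁ = ν • g₁ →
      S.τ g₂ = (-ν) • g₂ → (∀ t ∈ T, ∃ e : ℤ, (e = 1 ∨ e = -1) ∧ S.τ t = e • t) → ∀ b : ℕ,
      ∃ ℓ, b < ℓ ∧ S.Kol ℓ ∧ ∀ g ∈ AddSubgroup.closure (insert g₁ (insert g₂ (T : Set V))),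
        g ∈ S.A ℓ ↔ g ∈ AddSubgroup.closure (T : Set V))
    (K : ℕ) (s : ℕ → V) (hsel : ∀ i, s i ∈ S.Sel)
    (hτs : ∀ i ∈ Finset.Ioc 0 K, S.τ (s i) = (S.ε * (-1) ^ i) • s i)
    (hiso : ∀ i ∈ Finset.Ioc 0 K, ∀ i' ∈ Finset.Ioc 0 K, P ⟨s i, hsel i⟩ ⟨s i', hsel i'⟩ = 0)
    (hind : ∀ (b : ℤ) (a : ℕ → ℤ), b • S.x + ∑ i ∈ Finset.Ioc 0 K, a i • s i = 0 →
      b • S.x = 0 ∧ ∀ i ∈ Finset.Ioc 0 K, a i • s i = 0)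
    (hroom : ∀ i ∈ Finset.Ioc 0 K, S.expo (s i) + S.M₀ ≤ S.M)
    (t : ℕ) (htM : t ≤ S.M) (hM₀ : S.M₀ ≤ S.M)
    (hdiv : ∀ n : ℕ, KolSupp S.Kol n → n.primeFactors.card = K →
      ((S.p : ℤ) ^ (S.M - t)) • S.c n = 0) :
    ∑ i ∈ Finset.Ioc 0 K, S.expo (s i) ≤ S.M₀ - t := by
  have := S.sum_expo_add_le_M₀_of_casselsTate_of_pow_smul_c_eq_zero P hCTV hCeb K s hsel hτs hiso
    hind hroom t htM hM₀ hdiv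
  omega

end HypothesesM

end KolyvaginDescent

end Literature.NumberTheory.EllipticCurves
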